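import Literature.Geometry.Kaehler.ComplexTorusTranscendentalLatticeBiduality
import Literature.Geometry.Kaehler.ComplexTorusIntegralHodgeClassesDirectSummand
import HarnessLib

/-!
# The dual quotients of the Hodge and transcendental lattices: `Hˡ(X, ℤ) ↠ Hdg^{k,p}(X, ℤ)^∨` with kernel `T`, and
# `Hᵏ(X, ℤ) ↠ T^∨` with kernel `Hdg^{k,p}(X, ℤ)` — `Hˡ(X, ℤ)/T ≅ Hdg^{k,p}(X, ℤ)^∨`, `Hᵏ(X, ℤ)/Hdg^{k,p}(X, ℤ) ≅ T^∨`

Layer `Literature/Geometry/Kaehler`, namespace `Literature.Geometry.Kaehler.ComplexTorus`; lane `lit-hodgefound` (Track 2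
foundations library), seat p09, generation 32, row g32-#4. THEOREMS ONLY (0 definitions); no named fact, net debt 0. Sequel of
`ComplexTorusTranscendentalLatticeBiduality` (g32-#2: `Hdg^{k,p}(X, ℤ) = T^⊥ ∩ Hᵏ(X, ℤ)` for the degree-`l` transcendental lattice
`T = Hdg^{k,p}(X, ℤ)^⊥ ∩ Hˡ(X, ℤ)` of g31-#11, `k + l = 2g`) and of `ComplexTorusIntegralHodgeClassesDirectSummand` (g31-#8:
`Hdg^{k,p}(X, ℤ)` is primitive in `Hᵏ(X, ℤ)`, hence a direct summand). For a complex torus `X = E/Φ(ℤ^ι)` the cup product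
`Hᵏ(X, ℤ) × Hˡ(X, ℤ) → ℤ` is a PERFECT pairing of free abelian groups (the tree's integral Poincaré duality
`existsUnique_integral_poincarePairing_eq(')`: `Hᵏ(X, ℤ) ⥲ Hom(Hˡ(X, ℤ), ℤ)` and `Hˡ(X, ℤ) ⥲ Hom(Hᵏ(X, ℤ), ℤ)`; Lange 2023 §6.2.4), and for a
PRIMITIVE sublattice of one side the restriction of functionals is onto (Huybrechts, Ch. 14 §0.2: "… as the canonical maps `Λ^* → Λᵢ^*` are
surjective", primitivity = torsion-free cokernel = direct summand). Read on the Hodge lattice `Hdg = Hdg^{k,p}(X, ℤ) ⊆ Hᵏ(X, ℤ)` and on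
the transcendental lattice `T ⊆ Hˡ(X, ℤ)`:

* §1 **`T` is primitive in `Hˡ(X, ℤ)`, hence a direct summand** (`Hˡ(X, ℤ) = T ⊕ K`; Kaplansky §7 Theorem 5 via the tree's
  `Purity.exists_isCompl_of_nsmulSaturated_of_fg`), and `Hˡ(X, ℤ)/T` is torsion free.
* §2 **every additive functional `φ : Hdg^{k,p}(X, ℤ) → ℤ` is `s ↦ ⟨s, x⟩` for some `x ∈ Hˡ(X, ℤ)`, unique modulo `T`**: the restriction
  `Hˡ(X, ℤ) ≅ Hᵏ(X, ℤ)^∨ → Hdg^∨` is ONTO with kernel `T` — so `Hˡ(X, ℤ)/T ≅ Hdg^{k,p}(X, ℤ)^∨` (extend `φ` to `Hᵏ(X, ℤ)` along a complement of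
  `Hdg`, then integral Poincaré duality).
* §3 dually **every additive functional `ψ : T → ℤ` is `t ↦ ⟨s, t⟩` for some `s ∈ Hᵏ(X, ℤ)`, unique modulo `Hdg^{k,p}(X, ℤ)`** (biduality
  g32-#2 identifies the kernel): `Hᵏ(X, ℤ)/Hdg^{k,p}(X, ℤ) ≅ T^∨`.
* §4 the packaged restriction maps `r : Hˡ(X, ℤ) → Hom(Hdg, ℤ)` and `r' : Hᵏ(X, ℤ) → Hom(T, ℤ)` (surjective, kernels `T`, `Hdg`) and the
  induced isomorphisms `Hˡ(X, ℤ)/T ≃+ Hom(Hdg^{k,p}(X, ℤ), ℤ)`, `Hᵏ(X, ℤ)/Hdg^{k,p}(X, ℤ) ≃+ Hom(T, ℤ)`.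

## Contents (theorems only)

* §1 **`nsmulSaturated_integralHodgeAnnihilator_addSubgroupOf`**, `isAddTorsionFree_quotient_integralHodgeAnnihilator`,
  **`exists_isCompl_integralHodgeAnnihilator_addSubgroupOf`**, `exists_isCompl_transcendentalSublatticeIn`.
* §2 **`exists_mem_integralForms_forall_poincarePairing_eq`** (`Hˡ(X, ℤ) ↠ Hdg^∨`), `sub_mem_integralHodgeAnnihilator_of_forall_poincarePairing_eq`
  (uniqueness mod `T`).
* §3 **`exists_mem_integralForms_forall_poincarePairing_eq'`** (`Hᵏ(X, ℤ) ↠ T^∨`), `sub_mem_integralHodgeClassesIn_of_forall_poincarePairing_eq`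
  (uniqueness mod `Hdg`).
* §4 **`exists_addMonoidHom_dual_integralHodgeClassesIn_surjective`** (`r`, its values, surjectivity, kernel `= T`),
  **`nonempty_quotient_integralHodgeAnnihilator_addEquiv_dual`** (`Hˡ(X, ℤ)/T ≃+ Hom(Hdg, ℤ)`),
  **`exists_addMonoidHom_dual_integralHodgeAnnihilator_surjective`** (`r'`), **`nonempty_quotient_integralHodgeClassesIn_addEquiv_dual`**
  (`Hᵏ(X, ℤ)/Hdg ≃+ Hom(T, ℤ)`).

## References

* [cite: Huybrechts2016K3, Ch. 14 §0.1–0.2 (PDF pp. 333–334: primitive embeddings; "the canonical maps `Λ^* → Λᵢ^*` are surjective"); Ch. 3 §2.2–2.3 (PDF pp. 58–59)]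
* [cite: Lange2023AbelianVarietiesComplex, §6.2.4 (p. 310: "the cup product pairing … yields the Poincaré duality `Hᵖ(X, ℤ) ⥲ H^{2g−p}(X, ℤ)^*`"); §7.2.2]
* [cite: Kaplansky1954, §7 (e) and Theorem 5 (PDF pp. 17–18)] (through `Literature.GroupTheory.Abelian.PureSubgroupFreeQuotient`)
* [cite: Ebeling1994, §1.1 before Prop. 1.2 (primitive sublattices, `K^⊥`)]
-/

noncomputable section

open Module Function
open Literature.GroupTheory.Abelian.Purity

namespace Literature.Geometry.Kaehler.ComplexTorus

section DualQuotients

variable {ι : Type*} [Fintype ι] [DecidableEq ι] {E : Type*} [NormedAddCommGroup E] [NormedSpace ℂ E]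
  (Φ : (ι → ℝ) ≃L[ℝ] E) {n k l : ℕ} (e : Fin n ≃ ι) (h : k + l = n) (p : ℕ)

/-! ## §1 `T` is a primitive sublattice of `Hˡ(X, ℤ)`, hence a direct summand -/

omit [Fintype ι] in
/-- **`T ⊂ Hˡ(X, ℤ)` is saturated (primitive)**: `n · x ∈ T`, `x ∈ Hˡ(X, ℤ)` `⟹` `n = 0` or `x ∈ T` (`⟨s, n x⟩ = n ⟨s, x⟩`; g31-#11's
`mem_integralHodgeAnnihilator_of_smul_mem`). [cite: Huybrechts2016K3, Ch. 14 §0.1 (PDF p. 333)] [cite: Ebeling1994, §1.1 before Prop. 1.2] -/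
theorem nsmulSaturated_integralHodgeAnnihilator_addSubgroupOf :
    ((integralForms Φ l ⊓ ⨅ s : integralHodgeClassesIn Φ k p,
        (LinearMap.ker (poincarePairing Φ e h (s : E [⋀^Fin k]→L[ℝ] ℂ))).toAddSubgroup).addSubgroupOf
      (integralForms Φ l)).toAddSubmonoid.NSMulSaturated := by
  intro m x hx
  rcases Nat.eq_zero_or_pos m with rfl | hm
  · exact Or.inl rfl
  refine Or.inr ?_
  have hx' : ((m • x : integralForms Φ l) : E [⋀^Fin l]→L[ℝ] ℂ) ∈ integralForms Φ l ⊓ ⨅ s : integralHodgeClassesIn Φ k p,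
      (LinearMap.ker (poincarePairing Φ e h (s : E [⋀^Fin k]→L[ℝ] ℂ))).toAddSubgroup := hx
  rw [AddSubmonoidClass.coe_nsmul, ← Nat.cast_smul_eq_nsmul ℂ] at hx'
  exact mem_integralHodgeAnnihilator_of_smul_mem Φ e h p (Nat.cast_ne_zero.2 hm.ne') x.2 hx'

omit [Fintype ι] in
/-- **`Hˡ(X, ℤ)/T` is torsion free.** [cite: Huybrechts2016K3, Ch. 14 §0.1 (PDF p. 333: "primitive if `Λ/Λ₁` is torsion free")] [cite: Kaplansky1954, §7 (e) (PDF p. 17)] -/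
theorem isAddTorsionFree_quotient_integralHodgeAnnihilator :
    IsAddTorsionFree (integralForms Φ l ⧸ (integralForms Φ l ⊓ ⨅ s : integralHodgeClassesIn Φ k p,
        (LinearMap.ker (poincarePairing Φ e h (s : E [⋀^Fin k]→L[ℝ] ℂ))).toAddSubgroup).addSubgroupOf (integralForms Φ l)) :=
  (nsmulSaturated_iff_isAddTorsionFree_quotient _).1 (nsmulSaturated_integralHodgeAnnihilator_addSubgroupOf Φ e h p)

/-- **`T` is a direct summand of `Hˡ(X, ℤ)`**: `Hˡ(X, ℤ) = T ⊕ K` for some subgroup `K` (a saturated subgroup of a finitely generated abelian group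
is a direct summand). [cite: Kaplansky1954, §7 (e) and Theorem 5 (PDF pp. 17–18)] [cite: Huybrechts2016K3, Ch. 14 §0.1 (PDF p. 333)] -/
theorem exists_isCompl_integralHodgeAnnihilator_addSubgroupOf :
    ∃ K : AddSubgroup (integralForms Φ l), IsCompl ((integralForms Φ l ⊓ ⨅ s : integralHodgeClassesIn Φ k p,
        (LinearMap.ker (poincarePairing Φ e h (s : E [⋀^Fin k]→L[ℝ] ℂ))).toAddSubgroup).addSubgroupOf (integralForms Φ l)) K := by
  haveI : Module.Finite ℤ (integralForms Φ l) := finite_integralForms Φ l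
  haveI : AddGroup.FG (integralForms Φ l) := Module.Finite.iff_addGroup_fg.1 inferInstance
  exact exists_isCompl_of_nsmulSaturated_of_fg (nsmulSaturated_integralHodgeAnnihilator_addSubgroupOf Φ e h p)

/-- **`Hˡ(X, ℤ) = T ⊕ K` with `K` a `ℤ`-submodule.** [cite: Kaplansky1954, §7 Theorem 5 (PDF pp. 17–18)] -/
theorem exists_isCompl_transcendentalSublatticeIn :
    ∃ K : Submodule ℤ (integralForms Φ l), IsCompl (AddSubgroup.toIntSubmodule ((integralForms Φ l ⊓ ⨅ s : integralHodgeClassesIn Φ k p,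
        (LinearMap.ker (poincarePairing Φ e h (s : E [⋀^Fin k]→L[ℝ] ℂ))).toAddSubgroup).addSubgroupOf (integralForms Φ l))) K := by
  obtain ⟨K, hK⟩ := exists_isCompl_integralHodgeAnnihilator_addSubgroupOf Φ e h p
  exact ⟨AddSubgroup.toIntSubmodule K, AddSubgroup.toIntSubmodule.isCompl hK⟩

/-! ## §2 `Hˡ(X, ℤ) ↠ Hdg^{k,p}(X, ℤ)^∨` with kernel `T` -/

/-- **Every additive functional on the Hodge lattice is a cup product with an integral class of complementary degree**: for
`φ : Hdg^{k,p}(X, ℤ) → ℤ` there is `x ∈ Hˡ(X, ℤ)` with `⟨s, x⟩ = φ(s)` for all `s ∈ Hdg^{k,p}(X, ℤ)` — the restriction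
`Hˡ(X, ℤ) ≅ Hᵏ(X, ℤ)^∨ → Hdg^∨` is onto, because `Hdg` is a direct summand of `Hᵏ(X, ℤ)` (g31-#8: extend `φ` along a complement) and the
cup product is unimodular (`existsUnique_integral_poincarePairing_eq'`). [cite: Huybrechts2016K3, Ch. 14 §0.2 (PDF p. 334: "the canonical maps `Λ^* → Λᵢ^*` are surjective")] [cite: Lange2023AbelianVarietiesComplex, §6.2.4 (p. 310)] -/
theorem exists_mem_integralForms_forall_poincarePairing_eq (φ : integralHodgeClassesIn Φ k p →+ ℤ) :
    ∃ x ∈ integralForms Φ l, ∀ (s : E [⋀^Fin k]→L[ℝ] ℂ) (hs : s ∈ integralHodgeClassesIn Φ k p),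
      poincarePairing Φ e h s x = φ ⟨s, hs⟩ := by
  obtain ⟨K, hK⟩ := exists_isCompl_hodgeSublatticeIn Φ k p
  -- `φ` read on the sublattice `Hdg ⊂ Hᵏ(X, ℤ)` and extended along the complement `K`
  let ψ : ↥(AddSubgroup.toIntSubmodule ((integralHodgeClassesIn Φ k p).addSubgroupOf (integralForms Φ k))) →+ ℤ :=
    AddMonoidHom.mk' (fun y ↦ φ ⟨((y : integralForms Φ k) : E [⋀^Fin k]→L[ℝ] ℂ), y.2⟩) fun a b ↦ by
      rw [← map_add]
      rfl
  let g : integralForms Φ k →+ ℤ :=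
    ψ.comp ((AddSubgroup.toIntSubmodule ((integralHodgeClassesIn Φ k p).addSubgroupOf (integralForms Φ k))).projectionOnto
      K hK).toAddMonoidHom
  obtain ⟨δ, hδ, -⟩ := existsUnique_integral_poincarePairing_eq' Φ e h g
  refine ⟨δ, δ.2, fun s hs ↦ ?_⟩
  have hsH : (⟨s, hs.1⟩ : integralForms Φ k) ∈
      AddSubgroup.toIntSubmodule ((integralHodgeClassesIn Φ k p).addSubgroupOf (integralForms Φ k)) := hs
  have h1 : poincarePairing Φ e h s (δ : E [⋀^Fin l]→L[ℝ] ℂ) = ((g ⟨s, hs.1⟩ : ℤ) : ℂ) := hδ ⟨s, hs.1⟩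
  rw [h1]
  congr 1
  change ψ ((AddSubgroup.toIntSubmodule ((integralHodgeClassesIn Φ k p).addSubgroupOf (integralForms Φ k))).projectionOnto
      K hK ⟨s, hs.1⟩) = φ ⟨s, hs⟩
  rw [Submodule.projectionOnto_apply_of_mem_left hK hsH]
  rfl

omit [Fintype ι] in
/-- **Uniqueness modulo `T`**: two integral classes of degree `l` with the same cup products against `Hdg^{k,p}(X, ℤ)` differ by an element
of the transcendental lattice. [cite: Huybrechts2016K3, Ch. 3 §2.2 (PDF p. 58) and Ch. 14 §0.2 (PDF p. 334)] -/
theorem sub_mem_integralHodgeAnnihilator_of_forall_poincarePairing_eq {x x' : E [⋀^Fin l]→L[ℝ] ℂ} (hx : x ∈ integralForms Φ l)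
    (hx' : x' ∈ integralForms Φ l) (hxx' : ∀ s ∈ integralHodgeClassesIn Φ k p, poincarePairing Φ e h s x = poincarePairing Φ e h s x') :
    x - x' ∈ integralForms Φ l ⊓ ⨅ s : integralHodgeClassesIn Φ k p,
        (LinearMap.ker (poincarePairing Φ e h (s : E [⋀^Fin k]→L[ℝ] ℂ))).toAddSubgroup :=
  (mem_integralHodgeAnnihilator_iff Φ e h p).2 ⟨sub_mem hx hx', fun s hs ↦ by rw [map_sub, hxx' s hs, sub_self]⟩

/-! ## §3 `Hᵏ(X, ℤ) ↠ T^∨` with kernel `Hdg^{k,p}(X, ℤ)` -/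

/-- **Every additive functional on the transcendental lattice is a cup product with an integral class of complementary degree**: for
`ψ : T → ℤ` there is `s ∈ Hᵏ(X, ℤ)` with `⟨s, t⟩ = ψ(t)` for all `t ∈ T` (`T` is a direct summand of `Hˡ(X, ℤ)`, §1, and the cup product is
unimodular, `existsUnique_integral_poincarePairing_eq`). [cite: Huybrechts2016K3, Ch. 14 §0.2 (PDF p. 334)] [cite: Lange2023AbelianVarietiesComplex, §6.2.4 (p. 310)] -/
theorem exists_mem_integralForms_forall_poincarePairing_eq'
    (ψ : ↥(integralForms Φ l ⊓ ⨅ s : integralHodgeClassesIn Φ k p,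
        (LinearMap.ker (poincarePairing Φ e h (s : E [⋀^Fin k]→L[ℝ] ℂ))).toAddSubgroup) →+ ℤ) :
    ∃ s ∈ integralForms Φ k, ∀ (t : E [⋀^Fin l]→L[ℝ] ℂ) (ht : t ∈ integralForms Φ l ⊓ ⨅ s : integralHodgeClassesIn Φ k p,
        (LinearMap.ker (poincarePairing Φ e h (s : E [⋀^Fin k]→L[ℝ] ℂ))).toAddSubgroup),
      poincarePairing Φ e h s t = ψ ⟨t, ht⟩ := by
  obtain ⟨K, hK⟩ := exists_isCompl_transcendentalSublatticeIn Φ e h p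
  let ψ' : ↥(AddSubgroup.toIntSubmodule ((integralForms Φ l ⊓ ⨅ s : integralHodgeClassesIn Φ k p,
        (LinearMap.ker (poincarePairing Φ e h (s : E [⋀^Fin k]→L[ℝ] ℂ))).toAddSubgroup).addSubgroupOf (integralForms Φ l))) →+ ℤ :=
    AddMonoidHom.mk' (fun y ↦ ψ ⟨((y : integralForms Φ l) : E [⋀^Fin l]→L[ℝ] ℂ), y.2⟩) fun a b ↦ by
      rw [← map_add]
      rfl
  let g : integralForms Φ l →+ ℤ :=
    ψ'.comp ((AddSubgroup.toIntSubmodule ((integralForms Φ l ⊓ ⨅ s : integralHodgeClassesIn Φ k p,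
        (LinearMap.ker (poincarePairing Φ e h (s : E [⋀^Fin k]→L[ℝ] ℂ))).toAddSubgroup).addSubgroupOf
          (integralForms Φ l))).projectionOnto K hK).toAddMonoidHom
  obtain ⟨γ, hγ, -⟩ := existsUnique_integral_poincarePairing_eq Φ e h g
  refine ⟨γ, γ.2, fun t ht ↦ ?_⟩
  have htT : (⟨t, ht.1⟩ : integralForms Φ l) ∈
      AddSubgroup.toIntSubmodule ((integralForms Φ l ⊓ ⨅ s : integralHodgeClassesIn Φ k p,
        (LinearMap.ker (poincarePairing Φ e h (s : E [⋀^Fin k]→L[ℝ] ℂ))).toAddSubgroup).addSubgroupOf (integralForms Φ l)) := ht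
  have h1 : poincarePairing Φ e h (γ : E [⋀^Fin k]→L[ℝ] ℂ) t = ((g ⟨t, ht.1⟩ : ℤ) : ℂ) := hγ ⟨t, ht.1⟩
  rw [h1]
  congr 1
  change ψ' ((AddSubgroup.toIntSubmodule ((integralForms Φ l ⊓ ⨅ s : integralHodgeClassesIn Φ k p,
      (LinearMap.ker (poincarePairing Φ e h (s : E [⋀^Fin k]→L[ℝ] ℂ))).toAddSubgroup).addSubgroupOf
        (integralForms Φ l))).projectionOnto K hK ⟨t, ht.1⟩) = ψ ⟨t, ht⟩
  rw [Submodule.projectionOnto_apply_of_mem_left hK htT]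
  rfl

/-- **Uniqueness modulo `Hdg^{k,p}(X, ℤ)`**: two integral classes of degree `k` with the same cup products against `T` differ by an integral
Hodge class (biduality, g32-#2). [cite: Huybrechts2016K3, Ch. 3 §2.2–2.3 (PDF pp. 58–59) and Ch. 14 §0.2 (PDF p. 334)] -/
theorem sub_mem_integralHodgeClassesIn_of_forall_poincarePairing_eq {s s' : E [⋀^Fin k]→L[ℝ] ℂ} (hs : s ∈ integralForms Φ k)
    (hs' : s' ∈ integralForms Φ k)
    (hss' : ∀ t ∈ integralForms Φ l ⊓ ⨅ s : integralHodgeClassesIn Φ k p,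
        (LinearMap.ker (poincarePairing Φ e h (s : E [⋀^Fin k]→L[ℝ] ℂ))).toAddSubgroup,
      poincarePairing Φ e h s t = poincarePairing Φ e h s' t) :
    s - s' ∈ integralHodgeClassesIn Φ k p :=
  (mem_integralHodgeClassesIn_iff_forall_poincarePairing_eq_zero Φ e h p (sub_mem hs hs')).2 fun t ht ↦ by
    rw [map_sub, LinearMap.sub_apply, hss' t ht, sub_self]

/-! ## §4 The restriction maps and the quotient isomorphisms -/

/-- **The restriction `r : Hˡ(X, ℤ) → Hom(Hdg^{k,p}(X, ℤ), ℤ)`, `x ↦ ⟨·, x⟩`, is ONTO with kernel `T`** (values: `r x s = ⟨s, x⟩ ∈ ℤ`,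
`poincarePairing_mem_range_int`). [cite: Huybrechts2016K3, Ch. 14 §0.2 (PDF p. 334)] [cite: Lange2023AbelianVarietiesComplex, §6.2.4 (p. 310)] -/
theorem exists_addMonoidHom_dual_integralHodgeClassesIn_surjective :
    ∃ r : integralForms Φ l →+ (integralHodgeClassesIn Φ k p →+ ℤ),
      (∀ (x : integralForms Φ l) (s : integralHodgeClassesIn Φ k p),
          ((r x s : ℤ) : ℂ) = poincarePairing Φ e h (s : E [⋀^Fin k]→L[ℝ] ℂ) (x : E [⋀^Fin l]→L[ℝ] ℂ)) ∧
        Surjective r ∧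
        r.ker = (integralForms Φ l ⊓ ⨅ s : integralHodgeClassesIn Φ k p,
          (LinearMap.ker (poincarePairing Φ e h (s : E [⋀^Fin k]→L[ℝ] ℂ))).toAddSubgroup).addSubgroupOf (integralForms Φ l) := by
  -- the integer values of the pairing, as an opaque function with its defining property
  obtain ⟨c, hc⟩ : ∃ c : integralForms Φ l → integralHodgeClassesIn Φ k p → ℤ, ∀ x s,
      ((c x s : ℤ) : ℂ) = poincarePairing Φ e h (s : E [⋀^Fin k]→L[ℝ] ℂ) (x : E [⋀^Fin l]→L[ℝ] ℂ) :=
    ⟨fun x s ↦ Classical.choose (poincarePairing_mem_range_int Φ e h s.2.1 x.2), fun x s ↦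
      (Classical.choose_spec (poincarePairing_mem_range_int Φ e h s.2.1 x.2)).symm⟩
  have hadd₁ : ∀ (x : integralForms Φ l) (s t : integralHodgeClassesIn Φ k p), c x (s + t) = c x s + c x t := fun x s t ↦ by
    apply Int.cast_injective (α := ℂ)
    rw [Int.cast_add, hc, hc, hc, AddSubgroup.coe_add, map_add, LinearMap.add_apply]
  have hadd₂ : ∀ (x y : integralForms Φ l) (s : integralHodgeClassesIn Φ k p), c (x + y) s = c x s + c y s := fun x y s ↦ by
    apply Int.cast_injective (α := ℂ)
    rw [Int.cast_add, hc, hc, hc, AddSubgroup.coe_add, map_add]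
  let r : integralForms Φ l →+ (integralHodgeClassesIn Φ k p →+ ℤ) :=
    AddMonoidHom.mk' (fun x ↦ AddMonoidHom.mk' (c x) (hadd₁ x)) fun x y ↦ by
      ext s
      exact hadd₂ x y s
  have hr : ∀ (x : integralForms Φ l) (s : integralHodgeClassesIn Φ k p),
      ((r x s : ℤ) : ℂ) = poincarePairing Φ e h (s : E [⋀^Fin k]→L[ℝ] ℂ) (x : E [⋀^Fin l]→L[ℝ] ℂ) := fun x s ↦ hc x s
  refine ⟨r, hr, fun φ ↦ ?_, ?_⟩
  · obtain ⟨x, hx, hφ⟩ := exists_mem_integralForms_forall_poincarePairing_eq Φ e h p φ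
    refine ⟨⟨x, hx⟩, ?_⟩
    ext s
    apply Int.cast_injective (α := ℂ)
    rw [hr, hφ s s.2]
  · ext x
    rw [AddMonoidHom.mem_ker, AddSubgroup.mem_addSubgroupOf, mem_integralHodgeAnnihilator_iff]
    constructor
    · intro hx
      refine ⟨x.2, fun s hs ↦ ?_⟩
      have h1 := hr x ⟨s, hs⟩
      rw [hx, AddMonoidHom.zero_apply, Int.cast_zero] at h1
      exact h1.symm
    · rintro ⟨-, hx⟩
      ext s
      apply Int.cast_injective (α := ℂ)
      rw [hr, AddMonoidHom.zero_apply, Int.cast_zero]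
      exact hx s s.2

/-- **`Hˡ(X, ℤ)/T ≅ Hom(Hdg^{k,p}(X, ℤ), ℤ)`**: the quotient of the degree-`l` lattice by the transcendental lattice is the dual of the
Hodge lattice of the complementary degree. [cite: Huybrechts2016K3, Ch. 14 §0.2 (PDF p. 334)] [cite: Lange2023AbelianVarietiesComplex, §6.2.4 (p. 310)] -/
theorem nonempty_quotient_integralHodgeAnnihilator_addEquiv_dual :
    Nonempty (integralForms Φ l ⧸ (integralForms Φ l ⊓ ⨅ s : integralHodgeClassesIn Φ k p,
        (LinearMap.ker (poincarePairing Φ e h (s : E [⋀^Fin k]→L[ℝ] ℂ))).toAddSubgroup).addSubgroupOf (integralForms Φ l) ≃+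
      (integralHodgeClassesIn Φ k p →+ ℤ)) := by
  obtain ⟨r, -, hr, hker⟩ := exists_addMonoidHom_dual_integralHodgeClassesIn_surjective Φ e h p
  rw [← hker]
  exact ⟨QuotientAddGroup.quotientKerEquivOfSurjective r hr⟩

/-- **The restriction `r' : Hᵏ(X, ℤ) → Hom(T, ℤ)`, `s ↦ ⟨s, ·⟩`, is ONTO with kernel `Hdg^{k,p}(X, ℤ)`.**
[cite: Huybrechts2016K3, Ch. 14 §0.2 (PDF p. 334) and Ch. 3 §2.2–2.3 (PDF pp. 58–59)] [cite: Lange2023AbelianVarietiesComplex, §6.2.4 (p. 310)] -/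
theorem exists_addMonoidHom_dual_integralHodgeAnnihilator_surjective :
    ∃ r' : integralForms Φ k →+ (↥(integralForms Φ l ⊓ ⨅ s : integralHodgeClassesIn Φ k p,
        (LinearMap.ker (poincarePairing Φ e h (s : E [⋀^Fin k]→L[ℝ] ℂ))).toAddSubgroup) →+ ℤ),
      (∀ (s : integralForms Φ k) (t : ↥(integralForms Φ l ⊓ ⨅ s : integralHodgeClassesIn Φ k p,
          (LinearMap.ker (poincarePairing Φ e h (s : E [⋀^Fin k]→L[ℝ] ℂ))).toAddSubgroup)),
          ((r' s t : ℤ) : ℂ) = poincarePairing Φ e h (s : E [⋀^Fin k]→L[ℝ] ℂ) (t : E [⋀^Fin l]→L[ℝ] ℂ)) ∧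
        Surjective r' ∧ r'.ker = (integralHodgeClassesIn Φ k p).addSubgroupOf (integralForms Φ k) := by
  obtain ⟨c, hc⟩ : ∃ c : integralForms Φ k → ↥(integralForms Φ l ⊓ ⨅ s : integralHodgeClassesIn Φ k p,
      (LinearMap.ker (poincarePairing Φ e h (s : E [⋀^Fin k]→L[ℝ] ℂ))).toAddSubgroup) → ℤ, ∀ s t,
      ((c s t : ℤ) : ℂ) = poincarePairing Φ e h (s : E [⋀^Fin k]→L[ℝ] ℂ) (t : E [⋀^Fin l]→L[ℝ] ℂ) :=
    ⟨fun s t ↦ Classical.choose (poincarePairing_mem_range_int Φ e h s.2 t.2.1), fun s t ↦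
      (Classical.choose_spec (poincarePairing_mem_range_int Φ e h s.2 t.2.1)).symm⟩
  have hadd₁ : ∀ s (t u : ↥(integralForms Φ l ⊓ ⨅ s : integralHodgeClassesIn Φ k p,
      (LinearMap.ker (poincarePairing Φ e h (s : E [⋀^Fin k]→L[ℝ] ℂ))).toAddSubgroup)), c s (t + u) = c s t + c s u := fun s t u ↦ by
    apply Int.cast_injective (α := ℂ)
    rw [Int.cast_add, hc, hc, hc, AddSubgroup.coe_add, map_add]
  have hadd₂ : ∀ (s s' : integralForms Φ k) t, c (s + s') t = c s t + c s' t := fun s s' t ↦ by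
    apply Int.cast_injective (α := ℂ)
    rw [Int.cast_add, hc, hc, hc, AddSubgroup.coe_add, map_add, LinearMap.add_apply]
  let r' : integralForms Φ k →+ (↥(integralForms Φ l ⊓ ⨅ s : integralHodgeClassesIn Φ k p,
      (LinearMap.ker (poincarePairing Φ e h (s : E [⋀^Fin k]→L[ℝ] ℂ))).toAddSubgroup) →+ ℤ) :=
    AddMonoidHom.mk' (fun s ↦ AddMonoidHom.mk' (c s) (hadd₁ s)) fun s s' ↦ by
      ext t
      exact hadd₂ s s' t
  have hr : ∀ (s : integralForms Φ k) (t : ↥(integralForms Φ l ⊓ ⨅ s : integralHodgeClassesIn Φ k p,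
      (LinearMap.ker (poincarePairing Φ e h (s : E [⋀^Fin k]→L[ℝ] ℂ))).toAddSubgroup)),
      ((r' s t : ℤ) : ℂ) = poincarePairing Φ e h (s : E [⋀^Fin k]→L[ℝ] ℂ) (t : E [⋀^Fin l]→L[ℝ] ℂ) := fun s t ↦ hc s t
  refine ⟨r', hr, fun ψ ↦ ?_, ?_⟩
  · obtain ⟨s, hs, hψ⟩ := exists_mem_integralForms_forall_poincarePairing_eq' Φ e h p ψ
    refine ⟨⟨s, hs⟩, ?_⟩
    ext t
    apply Int.cast_injective (α := ℂ)
    rw [hr, hψ t t.2]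
  · ext s
    rw [AddMonoidHom.mem_ker, AddSubgroup.mem_addSubgroupOf,
      mem_integralHodgeClassesIn_iff_forall_poincarePairing_eq_zero Φ e h p s.2]
    constructor
    · intro hs t ht
      have h1 := hr s ⟨t, ht⟩
      rw [hs, AddMonoidHom.zero_apply, Int.cast_zero] at h1
      exact h1.symm
    · intro hs
      ext t
      apply Int.cast_injective (α := ℂ)
      rw [hr, AddMonoidHom.zero_apply, Int.cast_zero]
      exact hs t t.2

/-- **`Hᵏ(X, ℤ)/Hdg^{k,p}(X, ℤ) ≅ Hom(T, ℤ)`**: the quotient of the degree-`k` lattice by the Hodge lattice is the dual of the transcendental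
lattice of the complementary degree. [cite: Huybrechts2016K3, Ch. 14 §0.2 (PDF p. 334) and Ch. 3 §2.2–2.3 (PDF pp. 58–59)] [cite: Lange2023AbelianVarietiesComplex, §6.2.4 (p. 310)] -/
theorem nonempty_quotient_integralHodgeClassesIn_addEquiv_dual :
    Nonempty (integralForms Φ k ⧸ (integralHodgeClassesIn Φ k p).addSubgroupOf (integralForms Φ k) ≃+
      (↥(integralForms Φ l ⊓ ⨅ s : integralHodgeClassesIn Φ k p,
        (LinearMap.ker (poincarePairing Φ e h (s : E [⋀^Fin k]→L[ℝ] ℂ))).toAddSubgroup) →+ ℤ)) := by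
  obtain ⟨r', -, hr', hker⟩ := exists_addMonoidHom_dual_integralHodgeAnnihilator_surjective Φ e h p
  rw [← hker]
  exact ⟨QuotientAddGroup.quotientKerEquivOfSurjective r' hr'⟩

end DualQuotients

end Literature.Geometry.Kaehler.ComplexTorus
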